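import Mathlib
import Summits.ValiantsHypothesis.ValiantsHypothesis.Theses.ElementaryWordLength
import Literature.Computability.AlgebraicComplexity.HomogeneousCircuits
import Literature.Computability.AlgebraicComplexity.StandardFamilies
import Literature.Computability.AlgebraicComplexity.SetMultilinear

/-!
# Sketch — crux-ideate stmt-ValiantsHypothesis-6626 (WordPerSuperPoly), ideator 2, round 1

First lemmas of the two idea cards, stated over existing declarations (they need not be proved
here; they must elaborate).  `letter` / `HasWord` merely abbreviate the route's INLINE word
predicate (`Theses/ElementaryWordLength.lean`): a letter `(i, j, λ, y)` is the transvection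
`E_ij(λ · (1 | X y))`, a word computes `E_13(f)`.
-/

noncomputable section

set_option linter.dupNamespace false

open MvPolynomial

namespace Summit.ValiantsHypothesis.ValiantsHypothesis.Cruxes.WordPerSuperPoly.Sketch

open Literature.Computability.AlgebraicComplexity

/-- The route's letter semantics (inlined there): `E_{ij}(λ · y)` with `y = 1` or a variable. -/
def letter {σ : Type*} (l : Fin 3 × Fin 3 × ℂ × Option σ) :
    Matrix (Fin 3) (Fin 3) (MvPolynomial σ ℂ) :=
  Matrix.transvection l.1 l.2.1 (MvPolynomial.C l.2.2.1 * l.2.2.2.elim 1 MvPolynomial.X)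

/-- `HasWord f L`: the transvection `E_13(f)` has an affine elementary word of length `≤ L`
(verbatim the existential of the route items). -/
def HasWord {σ : Type*} (f : MvPolynomial σ ℂ) (L : ℕ) : Prop :=
  ∃ w : List (Fin 3 × Fin 3 × ℂ × Option σ), w.length ≤ L ∧ (∀ l ∈ w, l.1 ≠ l.2.1) ∧
    (w.map letter).prod = Matrix.transvection (0 : Fin 3) 2 f

/-- Sanity: the crux in this notation. -/
example : Theses.ElementaryWordLength.WordPerSuperPoly ↔
    ∀ c : ℕ, ∃ n : ℕ, ¬ HasWord (perPoly (Fin n) ℂ) (n ^ c + c) := Iff.rfl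

/-! ## Card A — `quasihom-escalation` -/

/-- **A1 (first rung, open but "within reach" per FLST23 §1): homogeneous formulas for the
permanent are quasi-polynomially large.**  Every fan-in-two formula all of whose gates compute
homogeneous polynomials and which computes `per_n` has `≥ n^{c log n}` gates.  (Raz 2009 proves
this magnitude for MULTILINEAR formulas; FLST23 Thm 4 for WEIGHTED homogeneous formulas of a
different polynomial; the unweighted homogeneous case is open.) -/
def HomFormulaPerLB : Prop :=
  ∃ c : ℝ, 0 < c ∧ ∃ n₀ : ℕ, ∀ n ≥ n₀, ∀ P : ArithCircuit ℂ (Fin n × Fin n),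
    P.IsFormula → P.IsFanInTwo → P.IsHomogeneousCircuit → P.Computes (perPoly (Fin n) ℂ) →
      (n : ℝ) ^ (c * Real.log n) ≤ (P.size : ℝ)

/-- **A1-word (the same rung in the route's language): degree-bounded words are long.**  A word
for `E_13(per_n)` all of whose PREFIX products have entries of total degree `≤ n²` (the image under
Ben-Or–Cleve of a quasi-homogeneous formula of syntactic degree `≤ n²/2`) has length
`≥ n^{c log n}`. -/
def DegreeBoundedWordPerLB : Prop :=
  ∃ c : ℝ, 0 < c ∧ ∃ n₀ : ℕ, ∀ n ≥ n₀, ∀ w : List (Fin 3 × Fin 3 × ℂ × Option (Fin n × Fin n)),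
    (∀ l ∈ w, l.1 ≠ l.2.1) →
    (w.map letter).prod = Matrix.transvection (0 : Fin 3) 2 (perPoly (Fin n) ℂ) →
    (∀ k ≤ w.length, ∀ i j : Fin 3, (((w.take k).map letter).prod i j).totalDegree ≤ n ^ 2) →
      (n : ℝ) ^ (c * Real.log n) ≤ (w.length : ℝ)

/-- **A1' (regime II, the load-bearing transfer target; TLS22 Cor. 2 proves `n^{Ω(log log n)}`):
set-multilinear formulas for `IMM_{n,n}` are quasi-polynomially large.**  "Set-multilinear formula" = every
gate computes a polynomial that is set-multilinear over some set of blocks, blocks = the matrix index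
`t : Fin n` of the variable `(t, i, j)` (LST21 §2).  By TLS22 p. 5 (self-reduction of IMM) + Raz 2013
(set-multilinearization at degree `O(log n / log log n)`), this implies `IMM ∉ VF`, hence the crux. -/
def SmlFormulaIMMLB : Prop :=
  ∃ c : ℝ, 0 < c ∧ ∃ n₀ : ℕ, ∀ n ≥ n₀, ∀ P : ArithCircuit ℂ (Fin n × Fin n × Fin n),
    P.IsFormula → P.IsFanInTwo →
    (∀ g ∈ ArithCircuit.gateValues P.gates, ∃ S : Finset (Fin n),
        IsSetMultilinear (fun v : Fin n × Fin n × Fin n => v.1) S g) →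
    P.Computes (immPoly n n ℂ) → (n : ℝ) ^ (c * Real.log n) ≤ (P.size : ℝ)

/-- **A2 (the transfer, FLST23 Cor. 6 + WordToFormula, stated as the implication the card bets
on): if degree-bounded words for `E_13(per_n)` have length `n^{Ω(log n)}` … the crux.**  The
printed bridge (quasi-homogenization of size `d^{o(log s)}`, char 0) is to be vendored as a
Literature fact; here only the shape of the reduction is recorded. -/
def EscalationBridge : Prop :=
  DegreeBoundedWordPerLB → Theses.ElementaryWordLength.WordPerSuperPoly

/-- **A3 (word = product-depth-1 formula for the noncommutative elementary symmetric
polynomials; DGIJL24 §6.2 / FLST23 App. A in the route's model).**  For a word whose constant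
letters have been conjugated away — here simply: a word with NO constant letters — the degree-`j`
homogeneous component of the `(1,3)` entry of the product is the `(1,3)` entry of
`E_j(A_1,…,A_L)`, the sum over increasing `j`-subsequences of the ordered products of the letter
matrices `A_t = λ_t X_{k_t} e_{i_t j_t}`.  (Provable now: expand `∏ (1 + A_t)`.) -/
def StrataAreNcElementarySymmetric : Prop :=
  ∀ (n : ℕ) (w : List (Fin 3 × Fin 3 × ℂ × Option (Fin n × Fin n))),
    (∀ l ∈ w, l.2.2.2 ≠ none) → ∀ j : ℕ,
    MvPolynomial.homogeneousComponent j ((w.map letter).prod 0 2) =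
      (((List.finRange w.length).sublistsLen j).map (fun T : List (Fin w.length) =>
          ((T.mergeSort (· ≤ ·)).map (fun t => letter (w.get t) - 1)).prod)).sum 0 2

/-! ## Card C — `word-composition-ladder` -/

/-- **C1 (direct sum by restriction; provable now).**  A word for `E_13(g₁ ⊕ g₂)` over disjoint
variable sets restricts (set the second block to `0`, append one constant letter cancelling
`g₂(0)`) to a word for `E_13(g₁)` using only its first-block and constant letters. -/
def DirectSumRestriction : Prop :=
  ∀ {σ τ : Type} (g₁ : MvPolynomial σ ℂ) (g₂ : MvPolynomial τ ℂ)
    (w : List (Fin 3 × Fin 3 × ℂ × Option (σ ⊕ τ))),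
    (∀ l ∈ w, l.1 ≠ l.2.1) →
    (w.map letter).prod =
      Matrix.transvection (0 : Fin 3) 2 (rename Sum.inl g₁ + rename Sum.inr g₂) →
    ∃ w₁ : List (Fin 3 × Fin 3 × ℂ × Option σ), (∀ l ∈ w₁, l.1 ≠ l.2.1) ∧
      (w₁.map letter).prod = Matrix.transvection (0 : Fin 3) 2 g₁ ∧
      w₁.length ≤ (w.filter (fun l => match l.2.2.2 with
        | some (Sum.inr _) => false
        | _ => true)).length + 1

/-- **C2 (composition upper bound = the dictionary row the ladder must match; provable now).**
Substituting, for each variable letter `E_ab(λ z_i)` of a word for `f`, a conjugate (by ≤ 24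
constant letters) of a word for `E_13(g_i)` gives a word for `E_13(f ∘ g)`. -/
def CompositionUpper : Prop :=
  ∀ {m : ℕ} {τ : Type} (f : MvPolynomial (Fin m) ℂ) (g : Fin m → MvPolynomial τ ℂ) (Lf Lg : ℕ),
    HasWord f Lf → (∀ i, HasWord (g i) Lg) → HasWord (MvPolynomial.aeval g f) (Lf * (Lg + 24))

/-- The generic multilinear polynomial on `m` "argument" variables `inr i` with a table of `2^m`
coefficient variables `inl S` (the algebraic multiplexer): `U_m = Σ_S T_S ∏_{i∈S} z_i`. -/
def genericMultilinear (m : ℕ) : MvPolynomial (Finset (Fin m) ⊕ Fin m) ℂ :=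
  ∑ S : Finset (Fin m), X (Sum.inl S) * ∏ i ∈ S, X (Sum.inr i)

/-- Two levels of the composition ladder: `U_m ∘ (U_m^{(1)}, …, U_m^{(m)})` on disjoint blocks
(root table `inl S`; block `i` = `inr (i, ·)`). -/
def ladderTwo (m : ℕ) :
    MvPolynomial (Finset (Fin m) ⊕ (Fin m × (Finset (Fin m) ⊕ Fin m))) ℂ :=
  MvPolynomial.aeval
    (Sum.elim (fun S => X (Sum.inl S))
      (fun i => rename (fun v => Sum.inr (i, v)) (genericMultilinear m)))
    (rename (Sum.map id id) (genericMultilinear m))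

/-- **C3 (level 2 of the ladder — the first statement beyond transcendence-degree methods):**
every word for `E_13(U_m ∘ U_m^{⊕m})` has length `≥ 4^m / m^c` (`N ≈ m·2^m` variables, so this
is `N^{2-o(1)}`; Ben-Or–Cleve / Horner give `O(m·4^m)`). -/
def LadderTwoLB : Prop :=
  ∃ c : ℕ, ∀ m ≥ 2, ∀ L : ℕ, HasWord (ladderTwo m) L → 4 ^ m ≤ L * m ^ c

/-- **C4 (the bet, one level, informal quantifiers made explicit): composition is multiplicative
up to `poly(m)` for the generic outer polynomial.**  For every inner family `g` on disjoint blocks,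
`wl(U_m ∘ g) ≥ 2^m · min_i wl(g_i) / m^c`. Iterated `k = log n / log log n` times this gives
`n^{Ω(log n / log log n)}` for a `VP` family, hence (VNP-completeness of `per`, projection
monotonicity of word length) the crux. -/
def CompositionStepLB : Prop :=
  ∃ c : ℕ, ∀ m ≥ 2, ∀ {τ : Type} (g : Fin m → MvPolynomial (Fin m × τ) ℂ) (Lg L : ℕ),
    (∀ i, ∃ h : MvPolynomial τ ℂ, g i = rename (fun v => (i, v)) h ∧ ¬ HasWord h Lg) →
    HasWord (MvPolynomial.aeval (Sum.elim (fun S : Finset (Fin m) => X (Sum.inl S))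
              (fun i => rename Sum.inr (g i))) (genericMultilinear m)) L →
    2 ^ m * Lg ≤ L * m ^ c

end Summit.ValiantsHypothesis.ValiantsHypothesis.Cruxes.WordPerSuperPoly.Sketch
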